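import Summits.RiemannHypothesis.RiemannHypothesis.Theses.LiTailLaguerre
import Summits.RiemannHypothesis.RiemannHypothesis.Theorems.LiTailLaguerreReleased
import HarnessLib

/-!
# RiemannHypothesis / LiTailLaguerre — crux K2′ `LiPrimeTailLaguerre` (DECIDING): the prime tail equals the released
# Coffey–Laguerre terms up to `O_c(1)` (RH-FREE)

RH-FREE [rh-li-prover g5].  Route `Theses/LiTailLaguerre.lean` (round 7 of the LI column, rung leaf «Li TAIL–LAGUERRE LAW»
`LiTheory.LiZeroTailLaguerre`, PROOF-OF-DATA, NOT height-buying), item `LiPrimeTailLaguerre` (stmt-RiemannHypothesis-19702):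
for every `c > 0` such that no prime power `m` has `log m = 1/c²` there are `N`, `C` with

  `|liPrimeTail n T − Σ_{2 ≤ m ≤ ⌊e^{1/c²}⌋} liCoffeyTerm m n| ≤ C log n`   (`n ≥ N`, `c√n ≤ T ≤ c√n + 1`).

Proof (parts 1–3 = `LiTailLaguerreNonreleased/Strip/Released`): `L(Λ, w)(2 − k_n(w)) = Σ_m Λ(m) m^{−w}(2 − k_n(w))`
converges absolutely on `Re w = 3/2` against the integrable majorant `Σ_m Λ(m)m^{−3/2} · n² e^{1/c²}/y²`, so
`π·liPrimeTail = Σ_m Λ(m) Re ∫_{Ioi T} m^{−w}(2 − k_n)` (dominated convergence).  With `δ = min_m |log m − 1/c²| > 0` over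
the prime powers `m ≤ e^{2/c²}` (the edge hypothesis) and `n ≥ N(c, δ)`: a prime power `m ≤ e^{1/c²}` is RELEASED with gap
`n/(T² + ¼) − log m ≥ δ/2` and contributes `π liCoffeyTerm m n + O(Λ(m) m^{−1/2})` (part 3: Cauchy shift + Laguerre bridge
+ first-derivative test on `[0, T]`); every other prime power has `log m − n/T² ≥ min(δ, 1/c²)` and contributes
`O(Λ(m) m^{−3/2})` (part 1); summing, the error is `≤ B(c, δ) Σ_m Λ(m) m^{−3/2} = O_c(1) ≤ C log n`.
Nothing here bears on the truth of RH: an identity-with-remainder between two explicit-formula bookkeepings.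
-/

noncomputable section

-- D-0017: `Summit.<S>.<S>.…` is the designed namespace of a single-problem summit.
set_option linter.dupNamespace false

open Complex MeasureTheory intervalIntegral Set Filter
open scoped Real Interval Topology ArithmeticFunction.vonMangoldt

namespace Summit.RiemannHypothesis.RiemannHypothesis.Theorems.LiTheory

open Literature.NumberTheory.LFunctions

namespace PrimeTail

open PrimeEdge TailContour GammaShift

/-! ### The gap `δ` given by the edge hypothesis -/

/-- From the edge hypothesis: a uniform gap `0 < δ ≤ 1/c²` between `1/c²` and `log m` for the prime powers
`m ≤ e^{2/c²}`. -/
theorem exists_gap {c : ℝ} (hc : 0 < c) (hedge : ∀ m : ℕ, 2 ≤ m → (Λ m : ℝ) ≠ 0 → Real.log m ≠ 1 / c ^ 2) :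
    ∃ δ : ℝ, 0 < δ ∧ δ ≤ 1 / c ^ 2 ∧
      ∀ m : ℕ, 2 ≤ m → m ≤ ⌊Real.exp (2 / c ^ 2)⌋₊ → (Λ m : ℝ) ≠ 0 → δ ≤ |Real.log m - 1 / c ^ 2| := by
  have hc2 : 0 < 1 / c ^ 2 := by positivity
  set S := (Finset.Icc 2 ⌊Real.exp (2 / c ^ 2)⌋₊).filter (fun m ↦ (Λ m : ℝ) ≠ 0) with hS
  by_cases hne : S.Nonempty
  · set δ₀ := S.inf' hne (fun m ↦ |Real.log m - 1 / c ^ 2|) with hδ₀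
    have hδ₀pos : 0 < δ₀ := by
      rw [hδ₀, Finset.lt_inf'_iff]
      intro m hm
      rw [hS, Finset.mem_filter, Finset.mem_Icc] at hm
      exact abs_pos.2 (sub_ne_zero.2 (hedge m hm.1.1 hm.2))
    refine ⟨min δ₀ (1 / c ^ 2), lt_min hδ₀pos hc2, min_le_right _ _, fun m hm hM hΛ ↦ ?_⟩
    refine (min_le_left _ _).trans (Finset.inf'_le _ ?_)
    rw [hS, Finset.mem_filter, Finset.mem_Icc]
    exact ⟨⟨hm, hM⟩, hΛ⟩
  · refine ⟨1 / c ^ 2, hc2, le_rfl, fun m hm hM hΛ ↦ ?_⟩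
    exact absurd ⟨m, by rw [hS, Finset.mem_filter, Finset.mem_Icc]; exact ⟨⟨hm, hM⟩, hΛ⟩⟩ hne

/-- A released prime power: `m ≤ ⌊e^{1/c²}⌋` with `Λ(m) ≠ 0` has `log m ≤ 1/c² − δ`. -/
theorem log_le_of_released {c δ : ℝ} (hc : 0 < c)
    (hδ : ∀ m : ℕ, 2 ≤ m → m ≤ ⌊Real.exp (2 / c ^ 2)⌋₊ → (Λ m : ℝ) ≠ 0 → δ ≤ |Real.log m - 1 / c ^ 2|)
    {m : ℕ} (hm : 2 ≤ m) (hM : m ≤ ⌊Real.exp (1 / c ^ 2)⌋₊) (hΛ : (Λ m : ℝ) ≠ 0) :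
    Real.log m ≤ 1 / c ^ 2 - δ := by
  have hm0 : (0 : ℝ) < m := by exact_mod_cast (show 0 < m by omega)
  have hle : (m : ℝ) ≤ Real.exp (1 / c ^ 2) := (Nat.floor_le (Real.exp_pos _).le).trans' (by exact_mod_cast hM)
  have hlog : Real.log m ≤ 1 / c ^ 2 := by
    have := Real.log_le_log hm0 hle; rwa [Real.log_exp] at this
  have hM2 : m ≤ ⌊Real.exp (2 / c ^ 2)⌋₊ :=
    hM.trans (Nat.floor_le_floor (Real.exp_le_exp.2 (by
      apply div_le_div_of_nonneg_right (by norm_num) (by positivity))))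
  have h := hδ m hm hM2 hΛ
  rw [abs_of_nonpos (by linarith)] at h
  linarith

/-- A non-released prime power: `m > ⌊e^{1/c²}⌋` with `Λ(m) ≠ 0` has `log m ≥ 1/c² + min(δ, 1/c²)`. -/
theorem le_log_of_nonreleased {c δ : ℝ}
    (hδ : ∀ m : ℕ, 2 ≤ m → m ≤ ⌊Real.exp (2 / c ^ 2)⌋₊ → (Λ m : ℝ) ≠ 0 → δ ≤ |Real.log m - 1 / c ^ 2|)
    {m : ℕ} (hm : 2 ≤ m) (hM : ⌊Real.exp (1 / c ^ 2)⌋₊ < m) (hΛ : (Λ m : ℝ) ≠ 0) :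
    1 / c ^ 2 + min δ (1 / c ^ 2) ≤ Real.log m := by
  have hm0 : (0 : ℝ) < m := by exact_mod_cast (show 0 < m by omega)
  have hgt : Real.exp (1 / c ^ 2) < m := (Nat.lt_of_floor_lt hM)
  have hlog : 1 / c ^ 2 < Real.log m := by
    have := Real.log_lt_log (Real.exp_pos _) hgt; rwa [Real.log_exp] at this
  rcases le_or_gt m ⌊Real.exp (2 / c ^ 2)⌋₊ with h2 | h2
  · have h := hδ m hm h2 hΛ
    rw [abs_of_nonneg (by linarith)] at h
    linarith [min_le_left δ (1 / c ^ 2)]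
  · have hgt2 : Real.exp (2 / c ^ 2) < m := Nat.lt_of_floor_lt h2
    have hlog2 : 2 / c ^ 2 < Real.log m := by
      have := Real.log_lt_log (Real.exp_pos _) hgt2; rwa [Real.log_exp] at this
    have h12 : (2 : ℝ) / c ^ 2 = 1 / c ^ 2 + 1 / c ^ 2 := by ring
    have : 1 / c ^ 2 + min δ (1 / c ^ 2) ≤ 2 / c ^ 2 := by linarith [min_le_right δ (1 / c ^ 2), h12]
    linarith

/-! ### The cut separates from the released prime powers for large `n` -/

/-- For `n ≥ N(c, δ)` and `T ≤ c√n + 1`: `n/(T² + ¼) ≥ 1/c² − δ/2`, and `c√n ≥ 1`, `n ≥ 2`. -/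
theorem exists_N {c δ : ℝ} (hc : 0 < c) (hδ : 0 < δ) :
    ∃ N : ℕ, ∀ n : ℕ, N ≤ n → 2 ≤ n ∧ 1 ≤ c * Real.sqrt n ∧
      ∀ T : ℝ, 0 ≤ T → T ≤ c * Real.sqrt n + 1 → 1 / c ^ 2 - δ / 2 ≤ n / (T ^ 2 + 1 / 4) := by
  set A : ℝ := 2 / c + 5 / (4 * c ^ 2) with hA
  have hA0 : 0 < A := by positivity
  set K : ℝ := A * (2 / (δ * c ^ 2)) with hK
  have hK0 : 0 < K := by positivity
  refine ⟨⌈K ^ 2⌉₊ + ⌈1 / c ^ 2⌉₊ + 2, fun n hn ↦ ?_⟩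
  have hn2 : 2 ≤ n := by omega
  have hnr : (⌈K ^ 2⌉₊ : ℝ) + ⌈1 / c ^ 2⌉₊ + 2 ≤ n := by exact_mod_cast hn
  have hK2 : K ^ 2 ≤ n := (Nat.le_ceil _).trans (by linarith [Nat.cast_nonneg (α := ℝ) ⌈1 / c ^ 2⌉₊])
  have hc2n : 1 / c ^ 2 ≤ n := (Nat.le_ceil _).trans (by linarith [Nat.cast_nonneg (α := ℝ) ⌈K ^ 2⌉₊])
  have hn0 : (0 : ℝ) ≤ n := Nat.cast_nonneg n
  have hsq : Real.sqrt n ^ 2 = n := Real.sq_sqrt hn0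
  have hs0 : 0 ≤ Real.sqrt n := Real.sqrt_nonneg _
  have hKs : K ≤ Real.sqrt n := Real.le_sqrt_of_sq_le hK2
  have hs1 : 1 ≤ Real.sqrt n := by
    rw [← Real.sqrt_one]; exact Real.sqrt_le_sqrt (by norm_cast; omega)
  have hcs : 1 ≤ c * Real.sqrt n := by
    -- `c √n ≥ 1 ⟸ c² n ≥ 1`
    have h1 : 1 ≤ c ^ 2 * n := by
      rw [div_le_iff₀ (by positivity)] at hc2n; linarith
    have : (c * Real.sqrt n) ^ 2 = c ^ 2 * n := by rw [mul_pow, hsq]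
    nlinarith [mul_nonneg hc.le hs0]
  refine ⟨hn2, hcs, fun T hT0 hT ↦ ?_⟩
  have hD : 0 < T ^ 2 + 1 / 4 := by positivity
  rw [le_div_iff₀ hD]
  -- `(1/c² − δ/2)(T² + 1/4) ≤ (1/c² − δ/2)((c√n + 1)² + 1/4) ≤ n`
  have hT2 : T ^ 2 ≤ (c * Real.sqrt n + 1) ^ 2 := pow_le_pow_left₀ hT0 hT 2
  have hkey : (2 / c) * Real.sqrt n + 5 / (4 * c ^ 2) ≤ (δ * c ^ 2 / 2) * n := by
    have h1 : (2 / c) * Real.sqrt n + 5 / (4 * c ^ 2) ≤ A * Real.sqrt n := by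
      rw [hA]
      have : 5 / (4 * c ^ 2) ≤ 5 / (4 * c ^ 2) * Real.sqrt n := le_mul_of_one_le_right (by positivity) hs1
      nlinarith
    have h2 : A * Real.sqrt n ≤ (δ * c ^ 2 / 2) * (Real.sqrt n * Real.sqrt n) := by
      have : A = (δ * c ^ 2 / 2) * K := by rw [hK]; field_simp
      rw [this, mul_assoc]
      exact mul_le_mul_of_nonneg_left (mul_le_mul_of_nonneg_right hKs hs0) (by positivity)
    rw [← pow_two, hsq] at h2
    exact h1.trans h2
  rcases le_or_gt (1 / c ^ 2 - δ / 2) 0 with hneg | hpos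
  · calc (1 / c ^ 2 - δ / 2) * (T ^ 2 + 1 / 4) ≤ 0 := mul_nonpos_of_nonpos_of_nonneg hneg hD.le
      _ ≤ n := hn0
  · have hexp : (c * Real.sqrt n + 1) ^ 2 = c ^ 2 * n + 2 * c * Real.sqrt n + 1 := by
      calc (c * Real.sqrt n + 1) ^ 2 = c ^ 2 * Real.sqrt n ^ 2 + 2 * c * Real.sqrt n + 1 := by ring
        _ = c ^ 2 * n + 2 * c * Real.sqrt n + 1 := by rw [hsq]
    have hmono : (1 / c ^ 2 - δ / 2) * (2 * c * Real.sqrt n + 5 / 4) ≤ (1 / c ^ 2) * (2 * c * Real.sqrt n + 5 / 4) :=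
      mul_le_mul_of_nonneg_right (by linarith) (by positivity)
    have hcne : c ≠ 0 := hc.ne'
    calc (1 / c ^ 2 - δ / 2) * (T ^ 2 + 1 / 4) ≤ (1 / c ^ 2 - δ / 2) * ((c * Real.sqrt n + 1) ^ 2 + 1 / 4) := by
          gcongr
      _ = n - (δ * c ^ 2 / 2) * n + (1 / c ^ 2 - δ / 2) * (2 * c * Real.sqrt n + 5 / 4) := by
          rw [hexp]
          field_simp
          ring
      _ ≤ n - (δ * c ^ 2 / 2) * n + (1 / c ^ 2) * (2 * c * Real.sqrt n + 5 / 4) := by linarith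
      _ = n - (δ * c ^ 2 / 2) * n + ((2 / c) * Real.sqrt n + 5 / (4 * c ^ 2)) := by
          field_simp
      _ ≤ n := by linarith

/-! ### The crux -/

/-- **Crux K2′ `LiPrimeTailLaguerre` of route `LiTailLaguerre`** (stmt-RiemannHypothesis-19702; RH-FREE; DECIDING): for
`c > 0` with no prime power at `log m = 1/c²` there are `N`, `C` with
`|liPrimeTail n T − Σ_{m ∈ Icc 2 ⌊e^{1/c²}⌋} liCoffeyTerm m n| ≤ C log n` for `n ≥ N`, `c√n ≤ T ≤ c√n + 1`. -/
theorem liPrimeTailLaguerre_bound (c : ℝ) (hc : 0 < c)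
    (hedge : ∀ m : ℕ, 2 ≤ m → (Λ m : ℝ) ≠ 0 → Real.log m ≠ 1 / c ^ 2) :
    ∃ N : ℕ, ∃ C : ℝ, ∀ n : ℕ, N ≤ n → ∀ T : ℝ, c * Real.sqrt n ≤ T → T ≤ c * Real.sqrt n + 1 →
      |liPrimeTail n T - ∑ m ∈ Finset.Icc 2 ⌊Real.exp (1 / c ^ 2)⌋₊, liCoffeyTerm m n| ≤ C * Real.log n := by
  obtain ⟨δ, hδ0, hδc, hδ⟩ := exists_gap hc hedge
  obtain ⟨N, hN⟩ := exists_N hc hδ0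
  set δ₁ : ℝ := min δ (1 / c ^ 2) with hδ₁
  have hδ₁0 : 0 < δ₁ := lt_min hδ0 (by positivity)
  set E : ℝ := Real.exp (1 / c ^ 2) with hE
  set Brel : ℝ := E * (4 / Real.log 2 + 2 / (δ / 2) + 3 + E) with hBrel
  set Bnr : ℝ := 6 / Real.log 2 + 3 / (2 * c ^ 2 * Real.log 2 ^ 2) + E * (2 / δ₁ + 3 / (2 * c ^ 2 * δ₁ ^ 2)) with hBnr
  set B : ℝ := Brel + Bnr with hB
  set f : ℕ → ℂ := fun m ↦ (Λ m : ℂ) with hf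
  set S : ℝ := ∑' m : ℕ, ‖LSeries.term f (3 / 2 : ℂ) m‖ with hSdef
  have hsum := summable_norm_term
  have hl2 : 0 < Real.log 2 := Real.log_pos (by norm_num)
  have hBrel0 : 0 ≤ Brel := by positivity
  have hBnr0 : 0 ≤ Bnr := by positivity
  refine ⟨N, 1 / Real.pi * (S * B) / Real.log 2, fun n hn T hT1 hT2 ↦ ?_⟩
  obtain ⟨hn2, hcs, hgapT⟩ := hN n hn
  have hn1 : 1 ≤ n := by omega
  have hT : 1 ≤ T := hcs.trans hT1
  have hT0 : 0 < T := by linarith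
  have hnT : (n : ℝ) / T ^ 2 ≤ 1 / c ^ 2 := by
    -- `T ≥ c√n` ⇒ `T² ≥ c² n`
    have hsq : Real.sqrt n ^ 2 = n := Real.sq_sqrt (Nat.cast_nonneg n)
    have h1 : c ^ 2 * n ≤ T ^ 2 := by
      have := pow_le_pow_left₀ (by positivity) hT1 2
      rw [mul_pow, hsq] at this; exact this
    rw [div_le_div_iff₀ (by positivity) (by positivity)]
    linarith
  have hET : Real.exp (n / T ^ 2) ≤ E := Real.exp_le_exp.2 hnT
  have hGap : ∀ m : ℕ, 2 ≤ m → m ≤ ⌊Real.exp (1 / c ^ 2)⌋₊ → (Λ m : ℝ) ≠ 0 →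
      δ / 2 ≤ n / (T ^ 2 + 1 / 4) - Real.log m := fun m hm hM hΛ ↦ by
    have := log_le_of_released hc hδ hm hM hΛ
    have := hgapT T hT0.le hT2
    linarith
  have hgnr : ∀ m : ℕ, 2 ≤ m → ⌊Real.exp (1 / c ^ 2)⌋₊ < m → (Λ m : ℝ) ≠ 0 →
      δ₁ ≤ Real.log m - n / T ^ 2 := fun m hm hM hΛ ↦ by
    have := le_log_of_nonreleased hδ hm hM hΛ
    linarith
  -- ### STEP 1: dominated convergence, `π liPrimeTail = Re Σ_m Λ(m) ∫ termIntegrand`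
  set Fm : ℕ → ℝ → ℂ := fun m y ↦ LSeries.term f (liRightPt y) m * liCoSymWeight n (liRightPt y) with hFm
  have hFm_eq : ∀ m y, Fm m y = (Λ m : ℂ) * termIntegrand n m y := fun m y ↦ by
    simp only [hFm, hf, term_eq, termIntegrand]; ring
  have hJ : HasSum (fun m ↦ ∫ y in Ioi T, Fm m y) (∫ y in Ioi T, primeIntegrand n y) := by
    refine hasSum_integral_of_dominated_convergence
      (fun m y ↦ ‖LSeries.term f (3 / 2 : ℂ) m‖ * (((n : ℝ) ^ 2 * E) * y ^ (-(2 : ℝ)))) ?_ ?_ ?_ ?_ ?_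
    · intro m; exact ((continuous_term m).mul (continuous_coSymWeight n)).aestronglyMeasurable
    · intro m
      refine (ae_restrict_iff' measurableSet_Ioi).2 (Filter.Eventually.of_forall fun y hy ↦ ?_)
      have hy0 : 0 < y := hT0.trans hy
      simp only [hFm]
      rw [norm_mul, norm_term_rightPt]
      refine mul_le_mul_of_nonneg_left ?_ (norm_nonneg _)
      have hdec := norm_liCoSymWeight_le_decay n (x := 3 / 2) ⟨by norm_num, le_rfl⟩ hy0
      have hw : ((3 / 2 : ℝ) : ℂ) + y * I = liRightPt y := by norm_num [liRightPt]
      rw [hw] at hdec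
      refine hdec.trans ?_
      have hey : Real.exp (n / y ^ 2) ≤ E :=
        (Real.exp_le_exp.2 (div_le_div_of_nonneg_left (Nat.cast_nonneg n) (by positivity)
          (pow_le_pow_left₀ hT0.le hy.le 2))).trans hET
      rw [Real.rpow_neg hy0.le, Real.rpow_two, div_eq_mul_inv]
      gcongr
    · exact Filter.Eventually.of_forall fun y ↦ hsum.mul_right _
    · have h := ((integrableOn_Ioi_rpow_of_lt (by norm_num : (-(2 : ℝ)) < -1) hT0).const_mul
        (S * ((n : ℝ) ^ 2 * E)))
      refine IntegrableOn.congr_fun h (fun y _ ↦ ?_) measurableSet_Ioi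
      rw [tsum_mul_right, hSdef, mul_assoc]
    · refine Filter.Eventually.of_forall fun y ↦ ?_
      have hre : (1 : ℝ) < (liRightPt y).re := by rw [liRightPt_re]; norm_num
      have hs : LSeriesSummable f (liRightPt y) := ArithmeticFunction.LSeriesSummable_vonMangoldt hre
      show HasSum (fun m ↦ LSeries.term f (liRightPt y) m * liCoSymWeight n (liRightPt y))
        (LSeries f (liRightPt y) * liCoSymWeight n (liRightPt y))
      exact hs.hasSum.mul_right _
  -- ### STEP 2: per-term errors
  set R := Finset.Icc 2 ⌊Real.exp (1 / c ^ 2)⌋₊ with hR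
  set g : ℕ → ℝ := fun m ↦ if m ∈ R then Real.pi * liCoffeyTerm m n else 0 with hg
  have herr : ∀ m, ‖(∫ y in Ioi T, Fm m y).re - g m‖ ≤ ‖LSeries.term f (3 / 2 : ℂ) m‖ * B := by
    intro m
    have hint_eq : ∫ y in Ioi T, Fm m y = (Λ m : ℂ) * ∫ y in Ioi T, termIntegrand n m y := by
      rw [← MeasureTheory.integral_const_mul]
      exact integral_congr_ae (Filter.Eventually.of_forall (hFm_eq m))
    rcases lt_or_ge m 2 with hm | hm
    · -- `m = 0, 1`: everything vanishes
      have h0 := vonMangoldt_eq_zero_of_lt_two hm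
      have hgm : g m = 0 := by simp only [hg, hR, Finset.mem_Icc]; rw [if_neg (by omega)]
      rw [hint_eq, h0, hgm]; simp; positivity
    have hm0 : 0 < m := by omega
    have hnt : ‖LSeries.term f (3 / 2 : ℂ) m‖ = (Λ m : ℝ) * (m : ℝ) ^ (-(3 / 2 : ℝ)) := norm_term_three_halves hm0
    by_cases hΛ : (Λ m : ℝ) = 0
    · have hgm : g m = 0 := by
        simp only [hg]; split_ifs
        · rw [liCoffeyTerm, hΛ]; simp
        · rfl
      rw [hint_eq, hgm, hΛ]; simp; positivity
    have hΛpos : 0 < (Λ m : ℝ) := lt_of_le_of_ne ArithmeticFunction.vonMangoldt_nonneg (Ne.symm hΛ)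
    have hre_eq : ((Λ m : ℂ) * ∫ y in Ioi T, termIntegrand n m y).re = (Λ m : ℝ) * (∫ y in Ioi T, termIntegrand n m y).re := by
      rw [Complex.re_ofReal_mul]
    by_cases hMm : m ∈ R
    · -- RELEASED
      have hM : m ≤ ⌊Real.exp (1 / c ^ 2)⌋₊ := (Finset.mem_Icc.1 hMm).2
      have hgm : g m = Real.pi * liCoffeyTerm m n := by simp only [hg]; rw [if_pos hMm]
      have hrel := re_setIntegral_termIntegrand_released hn1 hm hT (half_pos hδ0) (hGap m hm hM hΛ)
      have hmE : (m : ℝ) ≤ E := (Nat.floor_le (Real.exp_pos _).le).trans' (by exact_mod_cast hM)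
      have hlogm : Real.log 2 ≤ Real.log m := Real.log_le_log (by norm_num) (by exact_mod_cast hm)
      have hfac : 4 / Real.log m + 2 / (δ / 2) + 3 + Real.exp (n / T ^ 2) ≤ 4 / Real.log 2 + 2 / (δ / 2) + 3 + E := by
        gcongr
      -- `Λ(m)·(π/m)·L = π liCoffeyTerm`
      have hcoffey : (Λ m : ℝ) * (Real.pi / m * liLaguerreOne n (Real.log m)) = Real.pi * liCoffeyTerm m n := by
        rw [liCoffeyTerm]; ring
      rw [hint_eq, hre_eq, hgm, ← hcoffey, ← mul_sub, norm_mul, Real.norm_eq_abs, abs_of_pos hΛpos, hnt, mul_assoc]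
      refine mul_le_mul_of_nonneg_left ?_ hΛpos.le
      rw [Real.norm_eq_abs]
      refine (hrel.trans (mul_le_mul_of_nonneg_left hfac (by positivity))).trans ?_
      -- `m^{-1/2} X ≤ m^{-3/2} (E · X) ≤ m^{-3/2} B`
      have hpow : (m : ℝ) ^ (-(1 / 2 : ℝ)) = (m : ℝ) ^ (-(3 / 2 : ℝ)) * m := by
        rw [show (-(1 / 2 : ℝ)) = -(3 / 2 : ℝ) + 1 by norm_num, Real.rpow_add (by exact_mod_cast hm0), Real.rpow_one]
      rw [hpow, mul_assoc]
      refine mul_le_mul_of_nonneg_left ?_ (by positivity)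
      calc (m : ℝ) * (4 / Real.log 2 + 2 / (δ / 2) + 3 + E) ≤ E * (4 / Real.log 2 + 2 / (δ / 2) + 3 + E) := by
            gcongr
        _ = Brel := rfl
        _ ≤ B := by rw [hB]; linarith
    · -- NOT RELEASED
      have hM : ⌊Real.exp (1 / c ^ 2)⌋₊ < m := by
        rw [hR, Finset.mem_Icc, not_and, not_le] at hMm; exact hMm hm
      have hgm : g m = 0 := by simp only [hg]; rw [if_neg hMm]
      have hnr := norm_setIntegral_termIntegrand_le (n := n) hm hT hδ₁0 (hgnr m hm hM hΛ)
      have hlogm : Real.log 2 ≤ Real.log m := Real.log_le_log (by norm_num) (by exact_mod_cast hm)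
      have hfac : 6 / Real.log m + 3 * n / (2 * T ^ 2 * Real.log m ^ 2) +
          Real.exp (n / T ^ 2) * (2 / δ₁ + 3 * n / (2 * T ^ 2 * δ₁ ^ 2)) ≤ Bnr := by
        have hlm0 : 0 < Real.log m := hl2.trans_le hlogm
        have hTne : T ≠ 0 := hT0.ne'
        have hlmne : Real.log m ≠ 0 := hlm0.ne'
        have hcne : c ≠ 0 := hc.ne'
        have hl2ne : Real.log 2 ≠ 0 := hl2.ne'
        have hδ₁ne : δ₁ ≠ 0 := hδ₁0.ne'
        have hb : 1 / Real.log m ^ 2 ≤ 1 / Real.log 2 ^ 2 :=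
          one_div_le_one_div_of_le (by positivity) (pow_le_pow_left₀ hl2.le hlogm 2)
        have h1 : 3 * (n : ℝ) / (2 * T ^ 2 * Real.log m ^ 2) ≤ 3 / (2 * c ^ 2 * Real.log 2 ^ 2) := by
          calc 3 * (n : ℝ) / (2 * T ^ 2 * Real.log m ^ 2) = 3 / 2 * (n / T ^ 2) * (1 / Real.log m ^ 2) := by
                field_simp
            _ ≤ 3 / 2 * (1 / c ^ 2) * (1 / Real.log 2 ^ 2) := by gcongr
            _ = 3 / (2 * c ^ 2 * Real.log 2 ^ 2) := by field_simp
        have h2 : 3 * (n : ℝ) / (2 * T ^ 2 * δ₁ ^ 2) ≤ 3 / (2 * c ^ 2 * δ₁ ^ 2) := by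
          calc 3 * (n : ℝ) / (2 * T ^ 2 * δ₁ ^ 2) = 3 / 2 * (n / T ^ 2) * (1 / δ₁ ^ 2) := by
                field_simp
            _ ≤ 3 / 2 * (1 / c ^ 2) * (1 / δ₁ ^ 2) := by gcongr
            _ = 3 / (2 * c ^ 2 * δ₁ ^ 2) := by field_simp
        rw [hBnr]
        gcongr
      rw [hint_eq, hre_eq, hgm, sub_zero, norm_mul, Real.norm_eq_abs, abs_of_pos hΛpos, hnt, mul_assoc]
      refine mul_le_mul_of_nonneg_left ?_ hΛpos.le
      rw [Real.norm_eq_abs]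
      refine ((Complex.abs_re_le_norm _).trans (hnr.trans (mul_le_mul_of_nonneg_left hfac (by positivity)))).trans ?_
      refine mul_le_mul_of_nonneg_left ?_ (by positivity)
      rw [hB]; linarith
  -- ### STEP 3: sum the errors
  have hgsum : HasSum g (Real.pi * ∑ m ∈ R, liCoffeyTerm m n) := by
    have h : HasSum g (∑ m ∈ R, g m) :=
      hasSum_sum_of_ne_finset_zero (fun m hm ↦ by simp only [hg]; rw [if_neg hm])
    have hs : ∑ m ∈ R, g m = Real.pi * ∑ m ∈ R, liCoffeyTerm m n := by
      rw [Finset.mul_sum]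
      exact Finset.sum_congr rfl fun m hm ↦ by simp only [hg]; rw [if_pos hm]
    rwa [hs] at h
  have hJre : HasSum (fun m ↦ (∫ y in Ioi T, Fm m y).re) ((∫ y in Ioi T, primeIntegrand n y).re) := by
    have := Complex.reCLM.hasSum hJ
    simpa using this
  have hdiff : HasSum (fun m ↦ (∫ y in Ioi T, Fm m y).re - g m)
      ((∫ y in Ioi T, primeIntegrand n y).re - Real.pi * ∑ m ∈ R, liCoffeyTerm m n) := hJre.sub hgsum
  have hnorm : ‖(∫ y in Ioi T, primeIntegrand n y).re - Real.pi * ∑ m ∈ R, liCoffeyTerm m n‖ ≤ S * B := by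
    rw [← hdiff.tsum_eq]
    have := tsum_of_norm_bounded (hsum.mul_right B).hasSum herr
    rwa [tsum_mul_right] at this
  -- ### STEP 4: back to `liPrimeTail`
  have hπ : Real.pi ≠ 0 := Real.pi_pos.ne'
  have hfinal : liPrimeTail n T - ∑ m ∈ R, liCoffeyTerm m n =
      1 / Real.pi * ((∫ y in Ioi T, primeIntegrand n y).re - Real.pi * ∑ m ∈ R, liCoffeyTerm m n) := by
    rw [liPrimeTail_eq]
    field_simp
  rw [hfinal, abs_mul, abs_of_pos (by positivity : (0 : ℝ) < 1 / Real.pi)]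
  have hlogn : Real.log 2 ≤ Real.log n := Real.log_le_log (by norm_num) (by exact_mod_cast hn2)
  have hS0 : 0 ≤ S := tsum_nonneg fun _ ↦ norm_nonneg _
  have hSB : 0 ≤ 1 / Real.pi * (S * B) / Real.log 2 := by positivity
  calc 1 / Real.pi * |(∫ y in Ioi T, primeIntegrand n y).re - Real.pi * ∑ m ∈ R, liCoffeyTerm m n|
      ≤ 1 / Real.pi * (S * B) := by
        refine mul_le_mul_of_nonneg_left ?_ (by positivity)
        rw [← Real.norm_eq_abs]; exact hnorm
    _ = 1 / Real.pi * (S * B) / Real.log 2 * Real.log 2 := by field_simp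
    _ ≤ 1 / Real.pi * (S * B) / Real.log 2 * Real.log n := by gcongr

end PrimeTail

open PrimeTail in
/-- **Crux K2′ `LiPrimeTailLaguerre`** (stmt-RiemannHypothesis-19702), verbatim the route statement. -/
theorem liPrimeTailLaguerre_proof : Summit.RiemannHypothesis.RiemannHypothesis.Theses.LiTailLaguerre.LiPrimeTailLaguerre := by
  intro c hc hedge
  exact liPrimeTailLaguerre_bound c hc hedge

end Summit.RiemannHypothesis.RiemannHypothesis.Theorems.LiTheory

end
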